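import Summits.QuantumFields.YangMills.Theorems.BalabanLadderIRcofEquipartitionSeamSpectralDictTrace
import HarnessLib

/-!
# Crux `IRcof` (stmt-QuantumFields-26930) · line `equipartition_seam` (row 47) · stub D `KernelCurrency.SpectralDictV` — SPECTRAL DICTIONARY,
# PART 3∕5 — §6 kernel calculus on `L²(X, μ; ℂ)` (composed kernels, Koopman-twisted kernels, path kernels `pathK` of a real kernel, the block bound `|⟪φ, Bφ⟫| ≤ nrm ‖𝔸‖^{r+1} ‖φ‖²`)

SOURCE OF RECORD: `Cruxes/IRcof/Lines/equipartition_seam_SpectralDict.lean` (crux write 2e444f4e44a5, 1436 l.; author ideator ym-ir-idea-22 g7; critic ym-ir-crit-3 g5 TYPEREAD CLEAN + JUNK ∕ COSTUME ∕ SHRED PASS, bus l.≈1712, landing conditions L1–L4) — split VERBATIM along its §§ into ≤ 400-line Theorems files by LEAD prover ym-ir-line-ab-p1 g8 (LAND-ASK of idea-22 g7). §0 of the source (a verbatim copy of `Literature/Analysis/OperatorTheory/HermitianKernelSandwichedTrace.lean`) is NOT landed (condition L2): the part that needs it imports the Literature module by name.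

HONEST FRAMING.  Abstract operator theory on `L²(X, μ; ℂ)` (Koopman unitaries, joint eigenbasis, trace formulas, kernel calculus); nothing located on the lattice is proved by this file (stubs S1, S3ʷ, T, N, S5ᵛ of row 47 open; D is re-located onto the lattice stub L `SliceRealisationV` in the last part); row 47 class PWP, mechanism 0, width 0; `IRcof` ∕ `IR` 0∕1; the Yang–Mills mass gap (Clay) is NOT proved by anything in this tree; R4 closes only the conditional finite-𝕋⁴ rung `BalabanLadder.UV`.
-/

noncomputable section

open MeasureTheory Filter Function Topology
open scoped InnerProductSpace ComplexConjugate ENNReal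
open Literature.Analysis.OperatorTheory

namespace Summit.QuantumFields.YangMills.Cruxes.IRcof.EquipartitionSeam.SpectralDict

variable {X : Type*} [MeasurableSpace X] {μ : Measure X}

/-! ## §6  Kernel calculus on `L²(X, μ; ℂ)`

Compositions of bounded-kernel operators have the composed kernel (Fubini); the Koopman twist of a kernel
operator has the twisted kernel; the iterates of the operator of a REAL kernel `K` have the tree's path kernels
(`PathKernelDomination`, probability measure) as kernels; and a real kernel `B_k` dominated pointwise by
`nrm · P_r` has diagonal matrix coefficients `|⟪φ, B φ⟫| ≤ nrm ‖𝔸‖^{r+1} ‖φ‖²` (the species-norm clause of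
`SpectralDictOn`, via the modulus `|φ| ∈ L²`; no real/complex operator comparison is needed). -/

section KernelCalc

omit [MeasurableSpace X] in
/-- Auxiliary `nonneg_of_norm_le` of the spectral-dictionary port (its statement is its type; rôle explained in the module ∕ section docstrings). -/
private theorem nonneg_of_norm_le {K : X → X → ℂ} {C : ℝ} (hC : ∀ x y, ‖K x y‖ ≤ C) (x : X) : 0 ≤ C :=
  (norm_nonneg _).trans (hC x x)

/-- **Composition of kernel operators**: if `A₁ φ =ᵐ ∫ K₁(·, y) φ(y)` and `A₂ φ =ᵐ ∫ K₂(·, y) φ(y)` with bounded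
strongly measurable kernels on a finite measure space, then `(A₁ ∘ A₂) φ =ᵐ ∫ (∫ K₁(·, u) K₂(u, y) dμ(u)) φ(y) dμ(y)`
(Fubini; `L² ⊆ L¹`). [folklore] -/
theorem comp_ae_kernel [IsFiniteMeasure μ] {K₁ K₂ : X → X → ℂ} {C₁ C₂ : ℝ} {A₁ A₂ : Lp ℂ 2 μ →L[ℂ] Lp ℂ 2 μ}
    (hK₁ : StronglyMeasurable (uncurry K₁)) (hK₂ : StronglyMeasurable (uncurry K₂))
    (hC₁ : ∀ x y, ‖K₁ x y‖ ≤ C₁) (hC₂ : ∀ x y, ‖K₂ x y‖ ≤ C₂)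
    (hA₁ : ∀ φ : Lp ℂ 2 μ, (A₁ φ : X → ℂ) =ᵐ[μ] fun x => ∫ y, K₁ x y * φ y ∂μ)
    (hA₂ : ∀ φ : Lp ℂ 2 μ, (A₂ φ : X → ℂ) =ᵐ[μ] fun x => ∫ y, K₂ x y * φ y ∂μ) (φ : Lp ℂ 2 μ) :
    ((A₁.comp A₂) φ : X → ℂ) =ᵐ[μ] fun x => ∫ y, (∫ u, K₁ x u * K₂ u y ∂μ) * φ y ∂μ := by
  rw [ContinuousLinearMap.comp_apply]
  filter_upwards [hA₁ (A₂ φ)] with x hx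
  rw [hx]
  have h0C₁ : 0 ≤ C₁ := nonneg_of_norm_le hC₁ x
  have hφ : Integrable (fun y => (φ : X → ℂ) y) μ := (Lp.memLp φ).integrable one_le_two
  have h1 : ∫ u, K₁ x u * (A₂ φ : X → ℂ) u ∂μ = ∫ u, ∫ y, K₁ x u * (K₂ u y * φ y) ∂μ ∂μ := by
    refine integral_congr_ae ?_
    filter_upwards [hA₂ φ] with u hu
    rw [hu, ← integral_const_mul]
  rw [h1]
  have hint : Integrable (uncurry fun u y => K₁ x u * (K₂ u y * φ y)) (μ.prod μ) := by
    have h2 : Integrable (fun z : X × X => (1 : ℂ) * (φ : X → ℂ) z.2) (μ.prod μ) :=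
      (integrable_const (1 : ℂ)).mul_prod hφ
    have h3 : Integrable (fun z : X × X => (K₁ x z.1 * K₂ z.1 z.2) * ((1 : ℂ) * (φ : X → ℂ) z.2))
        (μ.prod μ) := by
      refine h2.bdd_mul (c := C₁ * C₂) ?_ (Eventually.of_forall fun z => ?_)
      · exact (((hK₁.of_uncurry_left (x := x)).comp_measurable measurable_fst).mul hK₂).aestronglyMeasurable
      · rw [norm_mul]
        exact mul_le_mul (hC₁ _ _) (hC₂ _ _) (norm_nonneg _) h0C₁
    refine h3.congr (Eventually.of_forall fun z => ?_)
    simp only [uncurry, one_mul]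
    ring
  rw [integral_integral_swap hint]
  refine integral_congr_ae (Eventually.of_forall fun y => ?_)
  dsimp only
  rw [← integral_mul_const]
  refine integral_congr_ae (Eventually.of_forall fun u => ?_)
  dsimp only
  ring

/-- **Koopman twist of a kernel operator**: `(U_T ∘ A) φ =ᵐ ∫ K(T ·, y) φ(y) dμ(y)`. [folklore] -/
theorem koop_comp_ae_kernel {K : X → X → ℂ} {A : Lp ℂ 2 μ →L[ℂ] Lp ℂ 2 μ}
    (hA : ∀ φ : Lp ℂ 2 μ, (A φ : X → ℂ) =ᵐ[μ] fun x => ∫ y, K x y * φ y ∂μ) {T : X → X}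
    (hT : MeasurePreserving T μ μ) (φ : Lp ℂ 2 μ) :
    (((koop T hT).comp A) φ : X → ℂ) =ᵐ[μ] fun x => ∫ y, K (T x) y * φ y ∂μ := by
  rw [ContinuousLinearMap.comp_apply]
  exact (coeFn_koop hT (A φ)).trans (ae_eq_comp_mp hT (hA φ))

/-- The composed kernel `(x, y) ↦ ∫ K₁(x, u) K₂(u, y) dμ(u)` is jointly strongly measurable. [folklore] -/
theorem stronglyMeasurable_compKernel [SFinite μ] {K₁ K₂ : X → X → ℂ} (hK₁ : StronglyMeasurable (uncurry K₁))
    (hK₂ : StronglyMeasurable (uncurry K₂)) :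
    StronglyMeasurable (uncurry fun x y => ∫ u, K₁ x u * K₂ u y ∂μ) := by
  have h : StronglyMeasurable (uncurry fun (p : X × X) (u : X) => K₁ p.1 u * K₂ u p.2) :=
    (hK₁.comp_measurable (measurable_fst.fst.prodMk measurable_snd)).mul
      (hK₂.comp_measurable (measurable_snd.prodMk measurable_fst.snd))
  exact h.integral_prod_right'

/-- The composed kernel is bounded by `C₁ C₂ μ(X)`. [folklore] -/
theorem norm_compKernel_le [IsFiniteMeasure μ] {K₁ K₂ : X → X → ℂ} {C₁ C₂ : ℝ} (hC₁ : ∀ x y, ‖K₁ x y‖ ≤ C₁)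
    (hC₂ : ∀ x y, ‖K₂ x y‖ ≤ C₂) (x y : X) :
    ‖∫ u, K₁ x u * K₂ u y ∂μ‖ ≤ C₁ * C₂ * μ.real Set.univ :=
  norm_integral_le_of_norm_le_const (Eventually.of_forall fun u => by
    rw [norm_mul]; exact mul_le_mul (hC₁ _ _) (hC₂ _ _) (norm_nonneg _) (nonneg_of_norm_le hC₁ x))

/-- The twisted kernel `(x, y) ↦ K(T x, y)` is jointly strongly measurable. [folklore] -/
theorem stronglyMeasurable_twistKernel {K : X → X → ℂ} (hK : StronglyMeasurable (uncurry K)) {T : X → X}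
    (hT : Measurable T) : StronglyMeasurable (uncurry fun x y => K (T x) y) :=
  hK.comp_measurable ((hT.comp measurable_fst).prodMk measurable_snd)

/-! ### Path kernels of a real kernel (the tree's `PathKernelDomination`, named) -/

/-- The `(r+1)`-step path kernel `P_r(u, y) = ∫ K(u, v₁) K(v₁, v₂) ⋯ K(v_r, y) dμ^{⊗r}(v)` of a real kernel
(the expression of `Literature.Analysis.OperatorTheory.PathKernelDomination`, given a name). [folklore] -/
def pathK (μ : Measure X) (K : X → X → ℝ) (r : ℕ) (u y : X) : ℝ :=
  ∫ v : Fin r → X, ∏ i : Fin (r + 1), K ((Fin.cons u (Fin.snoc v y) : Fin (r + 2) → X) (Fin.castSucc i))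
    ((Fin.cons u (Fin.snoc v y) : Fin (r + 2) → X) (Fin.succ i)) ∂(Measure.pi fun _ => μ)

section PathK

variable [IsProbabilityMeasure μ] {K : X → X → ℝ} {C : ℝ}

/-- Auxiliary `pathK_zero` of the spectral-dictionary port (its statement is its type; rôle explained in the module ∕ section docstrings). -/
theorem pathK_zero (K : X → X → ℝ) (u y : X) : pathK μ K 0 u y = K u y := by
  unfold pathK
  rw [pathKernel_eq K 0 u y]
  simp [integral_const, probReal_univ]

/-- Auxiliary `pathK_succ` of the spectral-dictionary port (its statement is its type; rôle explained in the module ∕ section docstrings). -/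
theorem pathK_succ (hK : Measurable (uncurry K)) (hC : ∀ x y, ‖K x y‖ ≤ C) (r : ℕ) (u y : X) :
    pathK μ K (r + 1) u y = ∫ y', K u y' * pathK μ K r y' y ∂μ := by
  unfold pathK
  exact pathKernel_succ hK hC r u y

/-- Auxiliary `measurable_pathK` of the spectral-dictionary port (its statement is its type; rôle explained in the module ∕ section docstrings). -/
theorem measurable_pathK (hK : Measurable (uncurry K)) (r : ℕ) : Measurable (uncurry (pathK μ K r)) :=
  measurable_pathKernel hK r

omit [IsProbabilityMeasure μ] in
/-- Auxiliary `norm_pathK_le` of the spectral-dictionary port (its statement is its type; rôle explained in the module ∕ section docstrings). -/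
theorem norm_pathK_le [IsProbabilityMeasure μ] (hC : ∀ x y, ‖K x y‖ ≤ C) (r : ℕ) (u y : X) :
    ‖pathK μ K r u y‖ ≤ C ^ (r + 1) :=
  norm_pathKernel_le hC r u y

/-- **The iterates of the operator of a real kernel have the path kernels as kernels**:
`𝔸^{r+1} φ =ᵐ ∫ P_r(·, y) φ(y) dμ(y)` on `L²(ℂ)` (induction: `pathK_succ` and `comp_ae_kernel`). [folklore] -/
theorem pow_succ_ae_pathK {A : Lp ℂ 2 μ →L[ℂ] Lp ℂ 2 μ} (hK : StronglyMeasurable (uncurry K))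
    (hC : ∀ x y, ‖K x y‖ ≤ C)
    (hA : ∀ φ : Lp ℂ 2 μ, (A φ : X → ℂ) =ᵐ[μ] fun x => ∫ y, ((K x y : ℝ) : ℂ) * φ y ∂μ) (r : ℕ)
    (φ : Lp ℂ 2 μ) :
    ((A ^ (r + 1)) φ : X → ℂ) =ᵐ[μ] fun x => ∫ y, ((pathK μ K r x y : ℝ) : ℂ) * φ y ∂μ := by
  induction r generalizing φ with
  | zero =>
    simp_rw [zero_add, pow_one, pathK_zero]
    exact hA φ
  | succ r ih =>
    have hKc : StronglyMeasurable (uncurry fun x y => ((K x y : ℝ) : ℂ)) :=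
      Complex.continuous_ofReal.comp_stronglyMeasurable hK
    have hPc : StronglyMeasurable (uncurry fun x y => ((pathK μ K r x y : ℝ) : ℂ)) :=
      Complex.continuous_ofReal.comp_stronglyMeasurable (measurable_pathK hK.measurable r).stronglyMeasurable
    have hCc : ∀ x y, ‖((K x y : ℝ) : ℂ)‖ ≤ C := fun x y => by rw [Complex.norm_real]; exact hC x y
    have hCP : ∀ x y, ‖((pathK μ K r x y : ℝ) : ℂ)‖ ≤ C ^ (r + 1) := fun x y => by
      rw [Complex.norm_real]; exact norm_pathK_le hC r x y
    have h := comp_ae_kernel hKc hPc hCc hCP hA ih φ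
    rw [pow_succ', ContinuousLinearMap.mul_def]
    refine h.trans (Eventually.of_forall fun x => ?_)
    refine integral_congr_ae (Eventually.of_forall fun y => ?_)
    dsimp only
    rw [pathK_succ hK.measurable hC r x y, ← integral_complex_ofReal]
    push_cast
    rfl

/-- **Diagonal coefficients of a dominated block.**  If `B φ =ᵐ ∫ B_k(·, y) φ(y)` with a real kernel
`|B_k(x, y)| ≤ nrm · P_r(x, y)` (`nrm ≥ 0`), then `|⟪φ, B φ⟫| ≤ nrm ‖𝔸‖^{r+1} ‖φ‖²` for every `φ ∈ L²(ℂ)`: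
`|⟪φ, Bφ⟫| ≤ ∬ |φ(x)| nrm P_r(x, y) |φ(y)| = nrm · Re ⟪|φ|, 𝔸^{r+1} |φ|⟫ ≤ nrm ‖𝔸‖^{r+1} ‖φ‖²`. [folklore] -/
theorem norm_inner_le_of_abs_le_pathK {Bk : X → X → ℝ} {CB nrm : ℝ} {A B : Lp ℂ 2 μ →L[ℂ] Lp ℂ 2 μ}
    (hK : StronglyMeasurable (uncurry K)) (hC : ∀ x y, ‖K x y‖ ≤ C)
    (hA : ∀ φ : Lp ℂ 2 μ, (A φ : X → ℂ) =ᵐ[μ] fun x => ∫ y, ((K x y : ℝ) : ℂ) * φ y ∂μ)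
    (hBk : StronglyMeasurable (uncurry Bk)) (hCB : ∀ x y, ‖Bk x y‖ ≤ CB)
    (hB : ∀ φ : Lp ℂ 2 μ, (B φ : X → ℂ) =ᵐ[μ] fun x => ∫ y, ((Bk x y : ℝ) : ℂ) * φ y ∂μ)
    (hnrm : 0 ≤ nrm) {r : ℕ} (hdom : ∀ x y, |Bk x y| ≤ nrm * pathK μ K r x y) (φ : Lp ℂ 2 μ) :
    ‖⟪φ, B φ⟫_ℂ‖ ≤ nrm * ‖A‖ ^ (r + 1) * ‖φ‖ ^ 2 := by
  -- the modulus `|φ|` as an element of `L²(ℂ)`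
  have hmem : MemLp (fun x => ((‖(φ : X → ℂ) x‖ : ℝ) : ℂ)) 2 μ := (Lp.memLp φ).norm.ofReal
  set ψ : Lp ℂ 2 μ := hmem.toLp _ with hψdef
  have hψae : (ψ : X → ℂ) =ᵐ[μ] fun x => ((‖(φ : X → ℂ) x‖ : ℝ) : ℂ) := hmem.coeFn_toLp
  have hψnorm : ‖ψ‖ = ‖φ‖ := by
    have h1 : ‖ψ‖ ^ 2 = ∫ x, ‖((‖(φ : X → ℂ) x‖ : ℝ) : ℂ)‖ ^ 2 ∂μ := norm_toLp_sq_eq_integral_norm_sq hmem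
    have h2 : ‖φ‖ ^ 2 = ∫ x, ‖(φ : X → ℂ) x‖ ^ 2 ∂μ := by
      have h := norm_toLp_sq_eq_integral_norm_sq (Lp.memLp φ)
      rwa [Lp.toLp_coeFn] at h
    simp_rw [Complex.norm_real, norm_norm] at h1
    exact (pow_left_inj₀ (norm_nonneg _) (norm_nonneg _) two_ne_zero).mp (h1.trans h2.symm)
  -- integrability bookkeeping
  have hφn : Integrable (fun y => ‖(φ : X → ℂ) y‖) μ := ((Lp.memLp φ).integrable one_le_two).norm
  have hPm : Measurable (uncurry (pathK μ K r)) := measurable_pathK hK.measurable r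
  set g : X → ℝ := fun x => ∫ y, pathK μ K r x y * ‖(φ : X → ℂ) y‖ ∂μ with hgdef
  have hgm : StronglyMeasurable g :=
    (hPm.stronglyMeasurable.mul ((Lp.stronglyMeasurable φ).norm.comp_measurable measurable_snd)).integral_prod_right'
  have hgb : ∀ x, ‖g x‖ ≤ C ^ (r + 1) * ∫ y, ‖(φ : X → ℂ) y‖ ∂μ := fun x => by
    rw [hgdef, ← integral_const_mul]
    refine norm_integral_le_of_norm_le (hφn.const_mul _) (Eventually.of_forall fun y => ?_)
    rw [norm_mul, norm_norm]
    exact mul_le_mul_of_nonneg_right (norm_pathK_le hC r x y) (norm_nonneg _)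
  have hI1 : ∀ x, Integrable (fun y => ‖Bk x y‖ * ‖(φ : X → ℂ) y‖) μ := fun x =>
    hφn.bdd_mul (c := CB) (hBk.of_uncurry_left (x := x)).norm.aestronglyMeasurable
      (Eventually.of_forall fun y => by rw [norm_norm]; exact hCB x y)
  have hI2 : ∀ x, Integrable (fun y => nrm * pathK μ K r x y * ‖(φ : X → ℂ) y‖) μ := fun x =>
    hφn.bdd_mul (c := ‖nrm‖ * C ^ (r + 1))
      ((hPm.of_uncurry_left (x := x)).const_mul nrm).aestronglyMeasurable
      (Eventually.of_forall fun y => by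
        rw [norm_mul]; exact mul_le_mul_of_nonneg_left (norm_pathK_le hC r x y) (norm_nonneg _))
  have hI3 : Integrable (fun x => ‖(φ : X → ℂ) x‖ * (nrm * g x)) μ :=
    hφn.mul_bdd (c := ‖nrm‖ * (C ^ (r + 1) * ∫ y, ‖(φ : X → ℂ) y‖ ∂μ))
      (hgm.const_mul nrm).aestronglyMeasurable
      (Eventually.of_forall fun x => by rw [norm_mul]; exact mul_le_mul_of_nonneg_left (hgb x) (norm_nonneg _))
  -- Step 1: the double-integral bound
  have hstep1 : ‖⟪φ, B φ⟫_ℂ‖ ≤ nrm * ∫ x, ‖(φ : X → ℂ) x‖ * g x ∂μ := by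
    rw [inner_eq_integral_of_ae_kernel hB φ φ]
    have hpt : ∀ x, ‖conj ((φ : X → ℂ) x) * ∫ y, ((Bk x y : ℝ) : ℂ) * φ y ∂μ‖ ≤
        ‖(φ : X → ℂ) x‖ * (nrm * g x) := fun x => by
      rw [norm_mul, RCLike.norm_conj]
      refine mul_le_mul_of_nonneg_left ?_ (norm_nonneg _)
      calc ‖∫ y, ((Bk x y : ℝ) : ℂ) * φ y ∂μ‖ ≤ ∫ y, ‖Bk x y‖ * ‖(φ : X → ℂ) y‖ ∂μ :=
            norm_integral_le_of_norm_le (hI1 x) (Eventually.of_forall fun y => by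
              rw [norm_mul, Complex.norm_real])
        _ ≤ ∫ y, nrm * pathK μ K r x y * ‖(φ : X → ℂ) y‖ ∂μ :=
            integral_mono (hI1 x) (hI2 x) fun y =>
              mul_le_mul_of_nonneg_right ((Real.norm_eq_abs _).le.trans (hdom x y)) (norm_nonneg _)
        _ = nrm * g x := by
            rw [hgdef, ← integral_const_mul]
            exact integral_congr_ae (Eventually.of_forall fun y => by dsimp only; ring)
    calc _ ≤ ∫ x, ‖(φ : X → ℂ) x‖ * (nrm * g x) ∂μ := norm_integral_le_of_norm_le hI3 (Eventually.of_forall hpt)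
      _ = nrm * ∫ x, ‖(φ : X → ℂ) x‖ * g x ∂μ := by
          rw [← integral_const_mul]
          exact integral_congr_ae (Eventually.of_forall fun x => by dsimp only; ring)
  -- Step 2: the double integral is `Re ⟪|φ|, 𝔸^{r+1} |φ|⟫`
  have hstep2 : (∫ x, ‖(φ : X → ℂ) x‖ * g x ∂μ : ℝ) = (⟪ψ, (A ^ (r + 1)) ψ⟫_ℂ).re := by
    rw [inner_eq_integral_of_ae_kernel (pow_succ_ae_pathK hK hC hA r) ψ ψ]
    have h : ∫ x, conj ((ψ : X → ℂ) x) * ∫ y, ((pathK μ K r x y : ℝ) : ℂ) * ψ y ∂μ ∂μ =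
        ∫ x, (((‖(φ : X → ℂ) x‖ * g x : ℝ)) : ℂ) ∂μ := by
      refine integral_congr_ae ?_
      filter_upwards [hψae] with x hx
      rw [hx, Complex.conj_ofReal, Complex.ofReal_mul]
      congr 1
      simp only [hgdef]
      rw [← integral_complex_ofReal]
      refine integral_congr_ae ?_
      filter_upwards [hψae] with y hy
      rw [hy]
      push_cast
      ring
    rw [h, integral_complex_ofReal, Complex.ofReal_re]
  -- Step 3: Cauchy–Schwarz and the operator norm
  have hstep3 : (⟪ψ, (A ^ (r + 1)) ψ⟫_ℂ).re ≤ ‖A‖ ^ (r + 1) * ‖φ‖ ^ 2 := by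
    calc (⟪ψ, (A ^ (r + 1)) ψ⟫_ℂ).re ≤ ‖⟪ψ, (A ^ (r + 1)) ψ⟫_ℂ‖ := Complex.re_le_norm _
      _ ≤ ‖ψ‖ * ‖(A ^ (r + 1)) ψ‖ := norm_inner_le_norm _ _
      _ ≤ ‖ψ‖ * (‖A ^ (r + 1)‖ * ‖ψ‖) := by gcongr; exact (A ^ (r + 1)).le_opNorm ψ
      _ ≤ ‖ψ‖ * (‖A‖ ^ (r + 1) * ‖ψ‖) := by gcongr; exact norm_pow_le' A r.succ_pos
      _ = ‖A‖ ^ (r + 1) * ‖φ‖ ^ 2 := by rw [hψnorm]; ring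
  calc ‖⟪φ, B φ⟫_ℂ‖ ≤ nrm * ∫ x, ‖(φ : X → ℂ) x‖ * g x ∂μ := hstep1
    _ = nrm * (⟪ψ, (A ^ (r + 1)) ψ⟫_ℂ).re := by rw [hstep2]
    _ ≤ nrm * (‖A‖ ^ (r + 1) * ‖φ‖ ^ 2) := mul_le_mul_of_nonneg_left hstep3 hnrm
    _ = nrm * ‖A‖ ^ (r + 1) * ‖φ‖ ^ 2 := by ring

end PathK

end KernelCalc

end Summit.QuantumFields.YangMills.Cruxes.IRcof.EquipartitionSeam.SpectralDict

end
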